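import Summits.ValiantsHypothesis.ValiantsHypothesis.Theorems.VPBoundarySquareIntSkeleton
import HarnessLib

/-!
# The boundary square of `VP`: BINARY NORMAL FORM — exponential format is height-free

Route `VPBoundarySquare`, census cell W22.next(2).  An integer skeleton of exponential format,
specialised at its constants `κ`, is a `0/1`-combination of terms `x^d · ∏_{j ∈ T} θ_j` in
polynomially many NUMBERS `θ` (`κ_j^(2^i)`, `2^(2^ℓ)`, `-1`): Bürgisser's repeated-squaring
multilinearisation [Burgisser2026HNC, §4.3, Lemma 4.11, pp. 13–14] read at the constants;
conversely a binary form is a skeleton of height `1`.  So for p-families FORMAT skeletons (the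
format content R1 of `U_CH = CHClosureDefinable`) and BINARY skeletons coincide, and `U_CH`
gives both: HEIGHT is not an axis of R1 (cf. [BCS1997] §9.4 pp. 260–264: height arguments live on
the closure; [KoiranPerifel2011]).  Theorem-only apart from the three `Prop`s of §0; no facts.
-/

noncomputable section

open MvPolynomial
open Literature.Computability.AlgebraicComplexity

namespace Summit.ValiantsHypothesis.ValiantsHypothesis.Theorems.VPBoundarySquareBinaryFormat

open Summit.ValiantsHypothesis.ValiantsHypothesis.Theses.VPBoundarySquare

variable {v : ℕ → ℕ}

/-- §0. BINARY FORM of `g` on the slots `θ`: `g = ∑_{(d,T) ∈ S} x^d · ∏_{j ∈ T} θ_j`, `S` a finite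
set of (exponent, slot-subset) pairs — coefficients `0/1`. [cite: Burgisser2026HNC, §4.3 (p. 13)] -/
def HasBinaryForm {m w : ℕ} (g : MvPolynomial (Fin m) ℂ) (θ : Fin w → ℂ) : Prop :=
  ∃ S : Finset ((Fin m →₀ ℕ) × Finset (Fin w)), g = ∑ p ∈ S, monomial p.1 (∏ j ∈ p.2, θ j)

/-- BINARY SKELETONS on polynomially many slots (the height-free form of R1).
[cite: Burgisser2026HNC, Lemma 4.11 (p. 14)] -/
def BinarySkeletons (f : ∀ n, MvPolynomial (Fin (v n)) ℂ) : Prop :=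
  ∃ w : ℕ → ℕ, IsPBounded w ∧ ∀ n, ∃ θ : Fin (w n) → ℂ, HasBinaryForm (f n) θ

/-- FORMAT SKELETONS: an exponential-format integer skeleton on polynomially many constants
(as in `CHClosureDefinable`, with `IsExpFormat`). [cite: Burgisser2026HNC, Def. 4.1 (p. 11)] -/
def FormatSkeletons (f : ∀ n, MvPolynomial (Fin (v n)) ℂ) : Prop :=
  ∃ (w : ℕ → ℕ) (Q : ∀ n, MvPolynomial (Fin (v n + w n)) ℤ) (κ : ∀ n, Fin (w n) → ℂ),
    IsExpFormat Q ∧ ∀ n,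
      f n = aeval (Fin.append X fun j => C (κ n j)) (MvPolynomial.map (Int.castRingHom ℂ) (Q n))

/-- §1. Every `a < 2^K` is a sum of distinct powers `2^i`, `i < K`. [folklore] -/
theorem exists_bitset (K : ℕ) : ∀ a < 2 ^ K, ∃ T ⊆ Finset.range K, ∑ i ∈ T, 2 ^ i = a := by
  induction K with
  | zero =>
    exact fun a ha => ⟨∅, Finset.empty_subset _, by rw [Finset.sum_empty, pow_zero] at *; omega⟩
  | succ K ih =>
    intro a ha
    by_cases h : a < 2 ^ K
    · exact (ih a h).imp fun T hT => ⟨hT.1.trans (Finset.range_mono K.le_succ), hT.2⟩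
    · obtain ⟨T, hT, hs⟩ := ih (a - 2 ^ K) (by rw [pow_succ] at ha; omega)
      have hK : K ∉ T := fun hk => by simpa using hT hk
      refine ⟨insert K T, Finset.insert_subset (by simp) (hT.trans (Finset.range_mono K.le_succ)),
        ?_⟩
      rw [Finset.sum_insert hK, hs]; omega

/-- A choice of binary digit sets for the numbers below `2^K`. [folklore] -/
theorem exists_bits (K : ℕ) : ∃ T : ℕ → Finset ℕ,
    ∀ a, a < 2 ^ K → T a ⊆ Finset.range K ∧ ∑ i ∈ T a, 2 ^ i = a := by
  classical
  refine ⟨fun a => if h : a < 2 ^ K then (exists_bitset K a h).choose else ∅, fun a ha => ?_⟩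
  simpa only [dif_pos ha] using (exists_bitset K a ha).choose_spec

/-- Digit sets determine the number: traces on `Fin K` agree ⟹ the numbers agree. [folklore] -/
theorem eq_of_bits_agree {K : ℕ} {T : ℕ → Finset ℕ}
    (hT : ∀ a, a < 2 ^ K → T a ⊆ Finset.range K ∧ ∑ i ∈ T a, 2 ^ i = a) {a b : ℕ}
    (ha : a < 2 ^ K) (hb : b < 2 ^ K) (h : ∀ i : Fin K, (i : ℕ) ∈ T a ↔ (i : ℕ) ∈ T b) :
    a = b := by
  have hab : T a = T b := Finset.ext fun t =>
    ⟨fun ht => (h ⟨t, Finset.mem_range.1 ((hT a ha).1 ht)⟩).1 ht,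
      fun ht => (h ⟨t, Finset.mem_range.1 ((hT b hb).1 ht)⟩).2 ht⟩
  rw [← (hT a ha).2, ← (hT b hb).2, hab]

/-- `∏_{i < K} (if i ∈ T then b^(2^i) else 1) = b^a` for a digit set `T` of `a`. [folklore] -/
theorem prod_ite_pow_two_pow {β : Type*} [CommMonoid β] (K : ℕ) {T : Finset ℕ}
    (hT : T ⊆ Finset.range K) {a : ℕ} (ha : ∑ i ∈ T, 2 ^ i = a) (b : β) :
    ∏ i : Fin K, (if (i : ℕ) ∈ T then b ^ 2 ^ (i : ℕ) else 1) = b ^ a := by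
  rw [Fin.prod_univ_eq_prod_range (fun i => if i ∈ T then b ^ 2 ^ i else 1) K,
    ← Finset.prod_filter, Finset.filter_mem_eq_inter, Finset.inter_eq_right.2 hT,
    Finset.prod_pow_eq_pow_sum, ha]

/-- §2. The `x`-part of an exponent vector on `Fin (m + w)`. [folklore] -/
def xPart {m w : ℕ} (e : Fin (m + w) →₀ ℕ) : Fin m →₀ ℕ :=
  Finsupp.equivFunOnFinite.symm fun i => e (Fin.castAdd w i)

/-- [folklore] -/ @[simp] theorem xPart_apply {m w : ℕ} (e : Fin (m + w) →₀ ℕ) (i : Fin m) :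
    xPart e i = e (Fin.castAdd w i) := by
  simp [xPart]

/-- Joint exponent of a pair `(d, T)`: `d` on the `x`-block, the indicator of `T` on the slots.
[folklore] -/
def jointExp {m w : ℕ} (p : (Fin m →₀ ℕ) × Finset (Fin w)) : Fin (m + w) →₀ ℕ :=
  Finsupp.equivFunOnFinite.symm (Fin.append (fun i => p.1 i) fun j => if j ∈ p.2 then 1 else 0)

/-- [folklore] -/ @[simp] theorem jointExp_castAdd {m w : ℕ} (p : (Fin m →₀ ℕ) × Finset (Fin w))
    (i : Fin m) : jointExp p (Fin.castAdd w i) = p.1 i := by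
  simp [jointExp]

/-- [folklore] -/ @[simp] theorem jointExp_natAdd {m w : ℕ} (p : (Fin m →₀ ℕ) × Finset (Fin w))
    (j : Fin w) : jointExp p (Fin.natAdd m j) = if j ∈ p.2 then 1 else 0 := by
  simp [jointExp]

/-- [folklore] -/
theorem jointExp_injective {m w : ℕ} :
    Function.Injective (jointExp : (Fin m →₀ ℕ) × Finset (Fin w) → _) := by
  intro p q hpq
  refine Prod.ext (Finsupp.ext fun i => ?_) (Finset.ext fun j => ?_)
  · rw [← jointExp_castAdd p i, ← jointExp_castAdd q i, hpq]
  · have h := congrArg (fun e => e (Fin.natAdd m j)) hpq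
    simp only [jointExp_natAdd] at h
    constructor <;> intro hj <;> by_contra hj' <;> simp [hj, hj'] at h

/-- Specialising one integer monomial at the constants `κ`. [folklore] -/
theorem aeval_append_monomial {m w : ℕ} (κ : Fin w → ℂ) (e : Fin (m + w) →₀ ℕ) (c : ℤ) :
    aeval (Fin.append X fun j => C (κ j)) (MvPolynomial.map (Int.castRingHom ℂ) (monomial e c)) =
      monomial (xPart e) ((c : ℂ) * ∏ j : Fin w, κ j ^ e (Fin.natAdd m j)) := by
  rw [map_monomial, aeval_monomial, Finsupp.prod_fintype _ _ fun i => pow_zero _,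
    Fin.prod_univ_add, monomial_eq, Finsupp.prod_fintype _ _ fun i => pow_zero _]
  simp only [Fin.append_left, Fin.append_right, eq_intCast, algebraMap_eq, xPart_apply, C_mul,
    map_prod, map_pow]
  ring

/-- The sign/absolute-value split of an integer, cast to `ℂ`. [folklore] -/
theorem intCast_eq_sign_mul_natAbs (c : ℤ) :
    (c : ℂ) = (if c < 0 then -1 else 1) * (c.natAbs : ℂ) := by
  rw [← Int.cast_natCast (R := ℂ) c.natAbs, Int.natCast_natAbs]
  split_ifs with hc
  · rw [abs_of_neg hc, Int.cast_neg]; ring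
  · rw [abs_of_nonneg (not_lt.1 hc)]; ring

/-- **Binary normal form** (Bürgisser 2026 §4.3 / Lemma 4.11 read at the constants): an integer
polynomial in `m` variables and `w` constant slots, of degree `< 2^M` and height `< 2^(2^L)`,
specialised at `κ`, has a binary form on `w·M+L+1` slots. [cite: Burgisser2026HNC, Lemma 4.11] -/
theorem hasBinaryForm_of_format {m w M L : ℕ} (Q : MvPolynomial (Fin (m + w)) ℤ)
    (hdeg : Q.totalDegree < 2 ^ M) (hht : ∀ e, (coeff e Q).natAbs < 2 ^ 2 ^ L)
    (κ : Fin w → ℂ) :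
    ∃ θ : Fin (w * M + L + 1) → ℂ,
      HasBinaryForm (aeval (Fin.append X fun j => C (κ j)) (MvPolynomial.map (Int.castRingHom ℂ) Q))
        θ := by
  classical
  obtain ⟨Tdeg, hTdeg⟩ := exists_bits M; obtain ⟨Tpow, hTpow⟩ := exists_bits L
  obtain ⟨Tbit, hTbit⟩ := exists_bits (2 ^ L)
  obtain ⟨θ, hθ⟩ : ∃ θ : (Fin w × Fin M) ⊕ Fin L ⊕ Unit → ℂ, θ = Sum.elim
      (fun p : Fin w × Fin M => κ p.1 ^ 2 ^ (p.2 : ℕ))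
      (Sum.elim (fun ℓ : Fin L => (2 : ℂ) ^ 2 ^ (ℓ : ℕ)) fun _ : Unit => -1) := ⟨_, rfl⟩
  let σ : ((Fin w × Fin M) ⊕ Fin L ⊕ Unit) ≃ Fin (w * M + L + 1) := Fintype.equivFinOfCardEq
    (by simp only [Fintype.card_sum, Fintype.card_prod, Fintype.card_fin, Fintype.card_unit]; omega)
  obtain ⟨P, hP⟩ : ∃ P : (Fin (m + w) →₀ ℕ) × ℕ → (Fin w × Fin M) ⊕ Fin L ⊕ Unit → Prop,
      ∀ ea, P ea = Sum.elim (fun p : Fin w × Fin M => (p.2 : ℕ) ∈ Tdeg (ea.1 (Fin.natAdd m p.1)))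
        (Sum.elim (fun ℓ : Fin L => (ℓ : ℕ) ∈ Tpow ea.2) fun _ : Unit => coeff ea.1 Q < 0) :=
    ⟨_, fun _ => rfl⟩
  obtain ⟨U, hU⟩ : ∃ U : (Fin (m + w) →₀ ℕ) × ℕ → Finset ((Fin w × Fin M) ⊕ Fin L ⊕ Unit),
      ∀ ea, U ea = Finset.univ.filter fun s => P ea s := ⟨_, fun _ => rfl⟩
  obtain ⟨I, hI⟩ : ∃ I : Finset ((Fin (m + w) →₀ ℕ) × ℕ), I =
      (Q.support ×ˢ Finset.range (2 ^ L)).filter fun ea => ea.2 ∈ Tbit (coeff ea.1 Q).natAbs :=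
    ⟨_, rfl⟩
  have hexp : ∀ e ∈ Q.support, ∀ j, e j < 2 ^ M := fun e he j =>
    lt_of_le_of_lt ((monomial_le_degreeOf j he).trans (degreeOf_le_totalDegree _ _)) hdeg
  have hIe : ∀ ea ∈ I, ea.1 ∈ Q.support ∧ ea.2 < 2 ^ L := fun ea hea => by
    rw [hI, Finset.mem_filter, Finset.mem_product, Finset.mem_range] at hea
    exact ⟨hea.1.1, hea.1.2⟩
  have hprod : ∀ ea ∈ I, (monomial (xPart ea.1) (∏ s ∈ U ea, θ s) : MvPolynomial (Fin m) ℂ) =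
      monomial (xPart ea.1) ((if coeff ea.1 Q < 0 then -1 else 1) * (2 : ℂ) ^ ea.2 *
        ∏ j : Fin w, κ j ^ ea.1 (Fin.natAdd m j)) := by
    intro ea hea
    obtain ⟨he, ha⟩ := hIe ea hea
    have h1 : ∀ j : Fin w, (∏ i : Fin M, if ((i : ℕ) ∈ Tdeg (ea.1 (Fin.natAdd m j))) then
        κ j ^ 2 ^ (i : ℕ) else 1) = κ j ^ ea.1 (Fin.natAdd m j) := fun j =>
      prod_ite_pow_two_pow M (hTdeg _ (hexp _ he _)).1 (hTdeg _ (hexp _ he _)).2 (κ j)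
    have h2 : (∏ ℓ : Fin L, if ((ℓ : ℕ) ∈ Tpow ea.2) then (2 : ℂ) ^ 2 ^ (ℓ : ℕ) else 1) =
        (2 : ℂ) ^ ea.2 := prod_ite_pow_two_pow L (hTpow _ ha).1 (hTpow _ ha).2 2
    rw [hU, Finset.prod_filter, Fintype.prod_sum_type, Fintype.prod_sum_type,
      Fintype.prod_prod_type]
    simp only [hθ, hP, Sum.elim_inl, Sum.elim_inr, h1, h2, Finset.univ_unique,
      Finset.prod_singleton]
    congr 1; ring
  have hsum : aeval (Fin.append X fun j => C (κ j)) (MvPolynomial.map (Int.castRingHom ℂ) Q) =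
      ∑ ea ∈ I, monomial (xPart ea.1) (∏ s ∈ U ea, θ s) := by
    rw [Finset.sum_congr rfl hprod, hI, Finset.sum_filter, Finset.sum_product]
    conv_lhs => rw [Q.as_sum, map_sum, map_sum]
    refine Finset.sum_congr rfl fun e _ => ?_
    have hc : ((coeff e Q).natAbs : ℂ) = ∑ i ∈ Tbit (coeff e Q).natAbs, (2 : ℂ) ^ i := by
      conv_lhs => rw [← (hTbit _ (hht e)).2, Nat.cast_sum]
      exact Finset.sum_congr rfl fun i _ => by rw [Nat.cast_pow, Nat.cast_ofNat]
    try dsimp only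
    rw [aeval_append_monomial, intCast_eq_sign_mul_natAbs (coeff e Q), hc, Finset.mul_sum,
      Finset.sum_mul, map_sum, ← Finset.sum_filter, Finset.filter_mem_eq_inter,
      Finset.inter_eq_right.2 (hTbit _ (hht e)).1]
  have hinj : Set.InjOn (fun ea => (xPart ea.1, (U ea).map σ.toEmbedding)) ↑I := by
    rintro ⟨e, a⟩ hea ⟨e', a'⟩ hea' h
    obtain ⟨he, ha⟩ := hIe _ hea; obtain ⟨he', ha'⟩ := hIe _ hea'
    obtain ⟨hx, hUU⟩ := Prod.mk.inj h
    have hmem : ∀ s, s ∈ U (e, a) ↔ s ∈ U (e', a') := fun s => by rw [Finset.map_injective _ hUU]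
    simp only [hU, Finset.mem_filter, Finset.mem_univ, true_and, hP, Sum.forall, Sum.elim_inl,
      Sum.elim_inr, Prod.forall] at hmem
    obtain ⟨hD, hA, -⟩ := hmem
    refine Prod.ext (Finsupp.ext fun y => ?_) (eq_of_bits_agree hTpow ha ha' hA)
    refine Fin.addCases (fun i => ?_) (fun j => ?_) y
    · simpa using congrArg (fun d => d i) hx
    · exact eq_of_bits_agree hTdeg (hexp _ he _) (hexp _ he' _) (hD j)
  refine ⟨θ ∘ σ.symm, I.image fun ea => (xPart ea.1, (U ea).map σ.toEmbedding), ?_⟩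
  rw [Finset.sum_image hinj, hsum]
  refine Finset.sum_congr rfl fun ea _ => ?_
  simp only [Finset.prod_map, Function.comp_apply, Equiv.coe_toEmbedding, Equiv.symm_apply_apply]

/-- **Converse**: a binary form on `w` slots is a `0/1` skeleton of degree `≤ deg g + w`. -/
theorem exists_format_of_hasBinaryForm {m w : ℕ} {g : MvPolynomial (Fin m) ℂ} {θ : Fin w → ℂ}
    (hg : HasBinaryForm g θ) :
    ∃ Q : MvPolynomial (Fin (m + w)) ℤ,
      Q.totalDegree ≤ g.totalDegree + w ∧ (∀ e, (coeff e Q).natAbs ≤ 1) ∧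
        g = aeval (Fin.append X fun j => C (θ j)) (MvPolynomial.map (Int.castRingHom ℂ) Q) := by
  classical
  obtain ⟨S₀, hg0⟩ := hg -- prune: the terms with exponent outside `supp g` sum to zero
  have hz : ∑ p ∈ S₀.filter (fun p => p.1 ∉ g.support), monomial p.1 (∏ j ∈ p.2, θ j) = 0 := by
    ext d; rw [coeff_sum, coeff_zero]; simp only [coeff_monomial]
    by_cases hd : d ∈ g.support
    · exact Finset.sum_eq_zero fun p hp =>
        if_neg fun h : p.1 = d => (Finset.mem_filter.1 hp).2 (h ▸ hd)
    · have hne : ∀ p ∈ S₀, (if p.1 = d then ∏ j ∈ p.2, θ j else 0) ≠ 0 → p.1 ∉ g.support :=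
        fun p _ hne hp1 => hne (if_neg fun h : p.1 = d => hd (h ▸ hp1))
      rw [Finset.sum_filter_of_ne hne]
      refine Eq.trans ?_ (notMem_support_iff.1 hd)
      rw [hg0, coeff_sum]; simp only [coeff_monomial]
  obtain ⟨S, hSdef⟩ : ∃ S, S = S₀.filter fun p => p.1 ∈ g.support := ⟨_, rfl⟩
  have hS : ∀ p ∈ S, p.1 ∈ g.support := fun p hp => by
    rw [hSdef, Finset.mem_filter] at hp; exact hp.2
  have hgS : g = ∑ p ∈ S, monomial p.1 (∏ j ∈ p.2, θ j) := by
    rw [← Finset.sum_filter_add_sum_filter_not S₀ fun p => p.1 ∈ g.support, hz, add_zero] at hg0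
    rw [hSdef]; exact hg0
  refine ⟨∑ p ∈ S, monomial (jointExp p) 1, ?_, fun e => ?_, ?_⟩
  · refine (totalDegree_finsetSum _ _).trans (Finset.sup_le fun p hp => ?_)
    refine (totalDegree_monomial_le _ _).trans ?_
    rw [Finsupp.sum_fintype _ _ fun _ => rfl, Fin.sum_univ_add]
    simp only [id_eq, jointExp_castAdd, jointExp_natAdd]
    refine Nat.add_le_add ?_ ((Finset.sum_le_card_nsmul _ _ 1 fun j _ => ?_).trans (by simp))
    · rw [← Finsupp.sum_fintype p.1 (fun _ e => e) fun _ => rfl]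
      exact le_totalDegree (hS p hp)
    · split_ifs <;> simp
  · rw [coeff_sum]; simp only [coeff_monomial]
    by_cases he : ∃ p ∈ S, jointExp p = e
    · obtain ⟨p, hp, rfl⟩ := he
      rw [Finset.sum_eq_single p (fun q _ hq => if_neg fun h => hq (jointExp_injective h))
        fun h => (h hp).elim]
      simp
    · rw [Finset.sum_eq_zero fun q hq => if_neg fun h => he ⟨q, hq, h⟩]
      simp
  · rw [hgS, map_sum, map_sum]
    refine Finset.sum_congr rfl fun p _ => ?_
    have hx : xPart (jointExp p) = p.1 := Finsupp.ext fun i => by simp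
    have hθ : (∏ j : Fin w, θ j ^ jointExp p (Fin.natAdd m j)) = ∏ j ∈ p.2, θ j := by
      simp only [jointExp_natAdd, pow_ite, pow_one, pow_zero, Finset.prod_ite_mem,
        Finset.univ_inter]
    rw [aeval_append_monomial, Int.cast_one, one_mul, hx, hθ]

/-- §3. **FORMAT ⟺ BINARY for p-families**: height is not an axis of R1.
[cite: Burgisser2026HNC, Lemma 4.11 (p. 14)] -/
theorem binarySkeletons_iff_formatSkeletons {f : ∀ n, MvPolynomial (Fin (v n)) ℂ}
    (hf : IsPFamily f) : BinarySkeletons f ↔ FormatSkeletons f := by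
  have hv : IsPBounded v := hf.1.mono fun n => by simp
  constructor
  · rintro ⟨w, hw, h⟩
    choose θ hθ using h
    choose Q hQdeg hQht hQf using fun n => exists_format_of_hasBinaryForm (hθ n)
    refine ⟨w, Q, θ, ⟨fun n => v n + w n + (f n).totalDegree + 1, IsPBounded.add_holds
      (IsPBounded.add_holds (IsPBounded.add_holds hv hw) hf.2) (IsPBounded.const 1), fun n => ?_⟩,
      hQf⟩
    have h1 : v n + w n ≤ v n + w n + (f n).totalDegree + 1 := by omega
    have h2 : (Q n).totalDegree ≤ 2 ^ (v n + w n + (f n).totalDegree + 1) :=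
      (hQdeg n).trans (le_trans (by omega) Nat.lt_two_pow_self.le)
    have h3 : ∀ e, (coeff e (Q n)).natAbs < 2 ^ 2 ^ (v n + w n + (f n).totalDegree + 1) :=
      fun e => (hQht n e).trans_lt (Nat.one_lt_two_pow (Nat.two_pow_pos _).ne')
    exact ⟨h1, h2, h3⟩
  · rintro ⟨w, Q, κ, ⟨p, hp, hQ⟩, hfQ⟩
    have hw : IsPBounded w :=
      hp.mono fun n => by have h1 : v n + w n ≤ p n := (hQ n).1; omega
    refine ⟨fun n => w n * (p n + 1) + p n + 1, IsPBounded.add_holds (IsPBounded.add_holds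
      (IsPBounded.mul_holds hw (IsPBounded.add_holds hp (IsPBounded.const 1))) hp)
        (IsPBounded.const 1), fun n => ?_⟩
    obtain ⟨-, hdeg, hht⟩ := hQ n
    obtain ⟨θ, hθ⟩ := hasBinaryForm_of_format (M := p n + 1) (L := p n) (Q n)
      (hdeg.trans_lt (Nat.pow_lt_pow_succ (by norm_num))) hht (κ n)
    exact hfQ n ▸ ⟨θ, hθ⟩

/-- `U_CH ⟹` format skeletons for `\overline{VP}` p-families. [cite: Burgisser2026HNC, Def. 4.1] -/
theorem formatSkeletons_of_chClosureDefinable (hU : CHClosureDefinable)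
    {f : ∀ n, MvPolynomial (Fin (v n)) ℂ} (hpf : IsPFamily f) (hbar : IsVPBarFamily f) :
    FormatSkeletons f :=
  let ⟨w, Q, κ, hQ, hfQ⟩ := hU v f hpf hbar; ⟨w, Q, κ, hQ.isExpFormat, hfQ⟩

/-- `U_CH ⟹` binary skeletons on polynomially many slots. [cite: Burgisser2026HNC, Lemma 4.11] -/
theorem binarySkeletons_of_chClosureDefinable (hU : CHClosureDefinable)
    {f : ∀ n, MvPolynomial (Fin (v n)) ℂ} (hpf : IsPFamily f) (hbar : IsVPBarFamily f) :
    BinarySkeletons f :=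
  (binarySkeletons_iff_formatSkeletons hpf).2 (formatSkeletons_of_chClosureDefinable hU hpf hbar)

end Summit.ValiantsHypothesis.ValiantsHypothesis.Theorems.VPBoundarySquareBinaryFormat
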